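import Mathlib
import Literature.MathematicalPhysics.QuantumFieldTheory.Balaban1983to89.B11Prop6Model
import Literature.MathematicalPhysics.QuantumFieldTheory.Balaban1983to89.B11Smallness

/-!
# `Balaban1983to89.B11Prop4Assembly` — T. Bałaban, *The variational problem and background fields in renormalization group method
# for lattice gauge theories*, Commun. Math. Phys. **102** (1985) 277–309 [Balaban1985Variational], **Proposition 4 (pp. 292–293)
# ASSEMBLED** from the five printed termwise estimates (86), (88), (89), (90), (91)–(96) of (δ/δA′)V — *"Gathering together all these
# estimates we get the following proposition"* — and threaded into the Sect. E scheme: the INPUT `Prop4Hyp` of the gen-6 Proposition-6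
# model (`B11Prop6Model.SchemeDatum.prop4`) is now PRODUCED from display leaves

statement-level skeleton of published theorems with citation tags; proofs where landed; nothing here is a claim about the Yang–Mills mass gap

PDF held: `paper:balaban1985-cmp102-variational-background` (journal page = PDF page + 276); pp. 291–293 [PDF 15–17] read by this seat from
`lit read` text and the render `…/b2b-balaban-ref1/pages/1985-cmp102-variational-background/…-p015-x2.png` (image).

CITATION HEADER (lean-in-tree rule 2026-08-18).  WHAT IS REPRODUCED: SKELETON rows (reader r08 `ROWS-B11.md`) **B11.Prop4** (decl of record
`B11.Prop4Printed C₁ B₃ fam`, typed-existing; gen-6 dictionary `B11Prop6Model.prop4Printed_model` = Prop. 4 as the INPUT `Prop4Hyp` of the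
Prop-6 scheme), **B11.Eq85** ((85)–(96), the termwise displays — kernels `B11Eq85FirstDerivative`, `B11Eq88Estimate`, `B11Eq93Commutator`),
**B11.Prop6** (`B11Prop6Model.prop6Printed_model`).

THE PRINT (pp. 291–293 [PDF 15–17], verbatim).  p. 291: *"Let us calculate and estimate the functional derivative of each term in V(A′)
separately. For the first term we have … (85) and from the bound (73) it follows that |⟨H(δ/δA′)D₃(A′), J⟩| ≦ … ≦ O(1)ε₁ε₃²(Lʲη)⁻³, b ∈ Bʲ(y),
y ∈ Λ_j. (86) We have gathered together all the constants into an absolute constant O(1). For the second term … hence the functional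
derivative is equal to … (88) Applying the inequalities (3.132) from [5], (55), (73), … we can estimate this functional derivative by
O(1)ε₃²(Lʲη)⁻³ on Ω_j. The functional derivative of the third term in V(A′) is equal to … (89) and can be estimated by O(1)ε₃³(Lʲη)⁻³ on
Ω_j. … This implies that the functional derivative (90) can be estimated by O(1)ε₃²(ε₁ + ε₃)(Lʲη)⁻³ on Ω_j."*  p. 292: *"The functional
derivative of these terms can be easily estimated by O(1)ε₃³(Lʲη)⁻³, if the covariant derivative in (39) acts on HD(A′). … and the
functional derivatives connected with the second and third terms are estimated easily by O(1)|DA′||A′|. … Thus these terms in (93) can be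
estimated by O(1)|∇A′||A′|. … the expression (95) can be estimated by O(1)|∇A′||A′| also.  Gathering together all these estimates we get the
following proposition.  Proposition 4. Let us consider the functional V(A′) on the space of configurations A′ with values in the complexified
Lie algebra 𝔤ᶜ, and satisfying the inequalities (77), i.e. max{|A′|₍₋₁₎, |∇A′|₍₋₂₎} < ε₃, for ε₃ ≦ a₃, where a₃ is a sufficiently small
positive constant. The functional derivative of V(A′) is an analytic function on this space, and satisfies the estimate |((δ/δA′)V)(A′)| <
C₄ε₃²(Lʲη)⁻³ on Ω_j, j = 0, 1, …, k. (97) The constants a₃, C₄ depend on d and L only. The above estimate can be formulated also in the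
following way: |((δ/δA′)V)(A′)|₍₋₃₎ ≦ C₄(max{|A′|₍₋₁₎, |∇A′|₍₋₂₎})², (98) and it is valid if max{|A′|₍₋₁₎, |∇A′|₍₋₂₎} ≦ a₃."*

WHAT IS CERTIFIED (kernel, sorry-free; axioms `propext` / `Classical.choice` / `Quot.sound`).  Over abstract complex normed spaces `𝒴`
(‖A′‖ = max{|A′|₍₋₁₎, |∇A′|₍₋₂₎}, the norm of (77)/(115)) and `𝒵` (‖·‖ = |·|₍₋₃₎):
§1 `TermwiseDatum 𝒴 𝒵 ε₁` — DATA: the five groups W₁ … W₅ of (85)/(88)/(89)/(90)/(91)–(96), the printed O(1)'s K₁ … K₅, the radius a of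
   «ε₃ sufficiently small»; LOCATED LEAVES: the five printed estimates and the analyticity of each group on {‖A′‖ < a}; `W` = the sum (85),
   `C4 c` = K₁c + K₂ + K₃ + K₄(c + 1) + K₅ + 1, `a3` = min{a, 1}.
§2 **`norm_W_le`**, **`ineq97`** — (97) with the printed strict sign: for ε₁ ≦ c, 0 < ε₃ ≦ a₃, ‖A′‖ < ε₃: ‖W(A′)‖ < C₄ε₃² (the five leaves
   summed; the arithmetic is `B11Smallness.prop4_gathering`, gen 1).
§3 **`ineq98_of_97`** (the passage (97) ⇒ (98): a bound Cε₃² for every ε₃ ∈ (‖A′‖, a₃] gives C‖A′‖², by continuity from the right — the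
   content of *"The above estimate can be formulated also in the following way"*), **`ineq98`**.
§4 **`differentiableOn_W`**, **`prop4Hyp : Prop4Hyp T.W (T.C4 c) T.a3`** — Proposition 4 in the Fréchet form of `B11Prop6Scheme`.
§5 `SchemeRest` (the Sect. E data other than W: L, d, 𝔊 with «Theorem 3.13 of [5]» ‖𝔊f‖ ≦ B₀|f|₍₋₃₎, J, H₁B), **`schemeDatum`** (a
   `B11Prop6Model.SchemeDatum` whose field `prop4` is `T.prop4Hyp` — the gen-6 INPUT now DISCHARGED from the leaves), and on the resulting
   `B11.LGData` family: **`prop4Printed_of_termwise : B11.Prop4Printed C₁ B₃ (fun i => (schemeDatum T hε₁c (R i)).toLGData C₁)`**,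
   **`prop6Printed_of_termwise : B11.Prop6Printed B₀ B₃ C₁ (same family)`** (by the gen-6 `prop4Printed_model` / `prop6Printed_model`).
With this file the Sect. D–E edge of the paper's DAG reads Prop 6 ⇐ {«Thm 3.13 of [5]» (norm of 𝔊), the five termwise displays (86)–(96)};
NON-VACUITY: `TermwiseDatum ℂ ℂ 1` is inhabited by quadratic/cubic maps (scratch `HOME/lit-balaban-r08/lean/scratch-Termwise-nonvacuity-g8.lean`,
rc 0; not filed).

HONEST SCOPE — what is NOT proved here: the five termwise estimates themselves and the analyticity of the groups (hypothesis fields of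
`TermwiseDatum`; their display-level kernels are the rows B11.Eq85 ff.: `B11Eq85FirstDerivative.ineq86`/`ineq90`, `B11Eq88Estimate.ineq88`/
`ineq89`, `B11Eq93Commutator.norm_fd93_le_eps3` — proved on their own carriers, not re-derived on `𝒴`/`𝒵` here); «Theorem 3.13 of [5]»;
(98) at the boundary ‖A′‖ = a₃ (the leaves are open-ball statements; a₃ here = min{a, 1}, and the typed (98) is served with a₃/2 by the
gen-6 dictionary).  No new named fact (`TermwiseDatum`/`SchemeRest` carry data + located hypotheses; `W`, `C4`, `a3`, `schemeDatum` are
definitions with bodies).  Mega-formalization `lit-balaban`, HOME `run/shared/lean/pub/lit-balaban/`, reader/typer seat r08 gen 8 (unit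
`lit-balaban-r08`, B11 fold owner).  Imports `B11Prop6Model`, `B11Smallness`; modifies nothing there.
(v1.1 DOCFIX, r08 gen 28, QUOTE-AUDIT-B11 A4/T2: the docstring of the field `TermwiseDatum.a` carried our gloss «All the restrictions
introduced up to now were of the form ε₃ ≦ O(1)» inside «…» with the locator «p. 290» — not a printed sentence (pp. 290–294 checked); now
marked as a reading next to the printed p. 293 sentence and (113); and the p. 292 sentence on (92) restored to the printed «O(1)|DA′||A′|»
(the v1 header wrote «|∇A′|», which print uses for (93)/(95) only). Declarations and proofs byte-identical.)
-/

namespace Literature.MathematicalPhysics.QuantumFieldTheory.Balaban1983to89.B11Prop4Assembly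

open Literature.MathematicalPhysics.QuantumFieldTheory.Balaban1983to89
open B11Prop6Scheme B11Prop6Model Filter Topology

/-! ## §1 The termwise decomposition (85) and the five printed estimates as located leaves -/

/-- **The termwise datum of Proposition 4** (pp. 291–292 [PDF 15–16]).  Carriers: `𝒴` = 𝔤ᶜ-valued configurations A′ with the norm of
(77)/(115), ‖A′‖ = max{|A′|₍₋₁₎, |∇A′|₍₋₂₎}; `𝒵` = currents with ‖·‖ = |·|₍₋₃₎ (sup over Ω_j of (Lʲη)³|·|, p. 293).  DATA: the five groups
of terms of (δ/δA′)V(A′) that the print estimates separately — `W₁` = the ⟨H(δ/δA′)D₃(A′), J⟩-term (85), `W₂` = the derivative (88) of the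
second term, `W₃` = the derivative (89) of the third term, `W₄` = the V′₀-term (90), `W₅` = the terms of pp. 291–292 connected with the first
expression of (39) ((91)–(96) and the HD(A′)-terms) —, the printed O(1) constants `K₁ … K₅`, the radius `a` of «ε₃ sufficiently small»
and the standing ε₁ of (14)/(28).  LOCATED LEAVES (hypotheses, each a printed estimate on Ω_j with the factor (Lʲη)⁻³ absorbed in ‖·‖ of
`𝒵`): (86) *"≦ O(1)ε₁ε₃²(Lʲη)⁻³"*; (88) *"we can estimate this functional derivative by O(1)ε₃²(Lʲη)⁻³ on Ω_j"*; (89) *"can be estimated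
by O(1)ε₃³(Lʲη)⁻³ on Ω_j"*; (90) *"can be estimated by O(1)ε₃²(ε₁ + ε₃)(Lʲη)⁻³ on Ω_j"*; (91)–(96) *"estimated easily by O(1)|DA′||A′|"* ((92)),
*"can be estimated by O(1)|∇A′||A′|"* ((93), (95)) / *"O(1)ε₃³(Lʲη)⁻³"* (≦ K₅ε₃² under (77), ε₃ ≦ 1) — each for A′ satisfying (77) with
parameter ε₃ ≦ a —, and the analyticity of each group
on {‖A′‖ < a} (p. 292: *"The functional derivative of V(A′) is an analytic function on this space"*; the groups are built from the analytic
D(A′) of Prop. 3, 𝔇 of (63)–(73), H, G and the polynomial V₀).  The display-level kernels of these leaves are the r08 modules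
`B11Eq85FirstDerivative` ((85)–(90), (92)), `B11Eq88Estimate` ((88)/(89) O(1) sentences), `B11Eq93Commutator` ((91), (93)–(96)),
`B11Eq37NormBound` ((40)); NOTHING of them is asserted here. [cite: Balaban1985Variational, (85)–(96) pp.291–292] -/
structure TermwiseDatum (𝒴 𝒵 : Type) [NormedAddCommGroup 𝒴] [NormedSpace ℂ 𝒴] [NormedAddCommGroup 𝒵] [NormedSpace ℂ 𝒵]
    (ε₁ : ℝ) where
  W₁ : 𝒴 → 𝒵
  W₂ : 𝒴 → 𝒵
  W₃ : 𝒴 → 𝒵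
  W₄ : 𝒴 → 𝒵
  W₅ : 𝒴 → 𝒵
  K₁ : ℝ
  K₂ : ℝ
  K₃ : ℝ
  K₄ : ℝ
  K₅ : ℝ
  /-- the radius of «ε₃ sufficiently small» ((113) p. 294; our reading: every restriction on ε₃ introduced up to Prop. 4 has the form
  ε₃ ≦ (a constant) — cf. p. 293: «All the representations and the estimates obtained up to now hold in this situation also, if we
  impose correspondingly stronger restrictions on ε₃ and change the constants») -/
  a : ℝ
  a_pos : 0 < a
  K₁_nonneg : 0 ≤ K₁
  K₃_nonneg : 0 ≤ K₃
  K₄_nonneg : 0 ≤ K₄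
  /-- (86) -/
  est86 : ∀ (ε₃ : ℝ) (Y : 𝒴), 0 < ε₃ → ε₃ ≤ a → ‖Y‖ < ε₃ → ‖W₁ Y‖ ≤ K₁ * ε₁ * ε₃ ^ 2
  /-- (88) -/
  est88 : ∀ (ε₃ : ℝ) (Y : 𝒴), 0 < ε₃ → ε₃ ≤ a → ‖Y‖ < ε₃ → ‖W₂ Y‖ ≤ K₂ * ε₃ ^ 2
  /-- (89) -/
  est89 : ∀ (ε₃ : ℝ) (Y : 𝒴), 0 < ε₃ → ε₃ ≤ a → ‖Y‖ < ε₃ → ‖W₃ Y‖ ≤ K₃ * ε₃ ^ 3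
  /-- (90) -/
  est90 : ∀ (ε₃ : ℝ) (Y : 𝒴), 0 < ε₃ → ε₃ ≤ a → ‖Y‖ < ε₃ → ‖W₄ Y‖ ≤ K₄ * ε₃ ^ 2 * (ε₁ + ε₃)
  /-- (91)–(96) -/
  est96 : ∀ (ε₃ : ℝ) (Y : 𝒴), 0 < ε₃ → ε₃ ≤ a → ‖Y‖ < ε₃ → ‖W₅ Y‖ ≤ K₅ * ε₃ ^ 2
  an₁ : DifferentiableOn ℂ W₁ {Y : 𝒴 | ‖Y‖ < a}
  an₂ : DifferentiableOn ℂ W₂ {Y : 𝒴 | ‖Y‖ < a}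
  an₃ : DifferentiableOn ℂ W₃ {Y : 𝒴 | ‖Y‖ < a}
  an₄ : DifferentiableOn ℂ W₄ {Y : 𝒴 | ‖Y‖ < a}
  an₅ : DifferentiableOn ℂ W₅ {Y : 𝒴 | ‖Y‖ < a}

namespace TermwiseDatum

variable {𝒴 𝒵 : Type} [NormedAddCommGroup 𝒴] [NormedSpace ℂ 𝒴] [NormedAddCommGroup 𝒵] [NormedSpace ℂ 𝒵] {ε₁ : ℝ}
  (T : TermwiseDatum 𝒴 𝒵 ε₁)

/-- **(85)**: (δ/δA′)V(A′) = the sum of the five estimated groups. [cite: Balaban1985Variational, (85) p.291] -/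
def W : 𝒴 → 𝒵 := fun Y => T.W₁ Y + T.W₂ Y + T.W₃ Y + T.W₄ Y + T.W₅ Y

/-- **C₄ of (97)** after *"Gathering together all these estimates"* (p. 292): with the standing smallness ε₁ ≦ c, the (d, L)-only constant
K₁c + K₂ + K₃ + K₄(c + 1) + K₅ of `B11Smallness.prop4_gathering` — plus 1, to carry the printed STRICT sign of (97).
[cite: Balaban1985Variational, (97) p.293] -/
def C4 (c : ℝ) : ℝ := T.K₁ * c + T.K₂ + T.K₃ + T.K₄ * (c + 1) + T.K₅ + 1

/-- **a₃ of (97)/(98)**: *"a₃ is a sufficiently small positive constant"* — here min{a, 1} (the radius of the termwise leaves, capped at 1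
so that ε₃³ ≦ ε₃²). [cite: Balaban1985Variational, Prop. 4 p.292] -/
noncomputable def a3 : ℝ := min T.a 1

/-- a₃ > 0. [cite: Balaban1985Variational, Prop. 4 p.292; bookkeeping] -/
theorem a3_pos : 0 < T.a3 := lt_min T.a_pos one_pos

/-- a₃ ≦ a (the termwise leaves apply on ‖A′‖ < ε₃ ≦ a₃). [cite: Balaban1985Variational, Prop. 4 p.292; bookkeeping] -/
theorem a3_le_a : T.a3 ≤ T.a := min_le_left _ _

/-- a₃ ≦ 1 (so ε₃³ ≦ ε₃² in the gathering). [cite: Balaban1985Variational, Prop. 4 p.292; bookkeeping] -/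
theorem a3_le_one : T.a3 ≤ 1 := min_le_right _ _

/-! ## §2 (97): «Gathering together all these estimates we get the following proposition» -/

/-- **(97), non-strict core**: for 0 < ε₃ ≦ a₃, ε₁ ≦ c and ‖A′‖ < ε₃, ‖((δ/δA′)V)(A′)‖₍₋₃₎ ≦ (K₁c + K₂ + K₃ + K₄(c+1) + K₅)ε₃² — the
five located leaves summed and gathered by `B11Smallness.prop4_gathering`. [cite: Balaban1985Variational, (97) pp.292–293] -/
theorem norm_W_le {c ε₃ : ℝ} (hε₁c : ε₁ ≤ c) (hε₃ : 0 < ε₃) (hε₃a : ε₃ ≤ T.a3) {Y : 𝒴} (hY : ‖Y‖ < ε₃) :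
    ‖T.W Y‖ ≤ (T.K₁ * c + T.K₂ + T.K₃ + T.K₄ * (c + 1) + T.K₅) * ε₃ ^ 2 := by
  have ha : ε₃ ≤ T.a := hε₃a.trans T.a3_le_a
  have h1 := T.est86 ε₃ Y hε₃ ha hY
  have h2 := T.est88 ε₃ Y hε₃ ha hY
  have h3 := T.est89 ε₃ Y hε₃ ha hY
  have h4 := T.est90 ε₃ Y hε₃ ha hY
  have h5 := T.est96 ε₃ Y hε₃ ha hY
  have hsum : ‖T.W Y‖ ≤ ‖T.W₁ Y‖ + ‖T.W₂ Y‖ + ‖T.W₃ Y‖ + ‖T.W₄ Y‖ + ‖T.W₅ Y‖ := by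
    unfold W
    calc ‖T.W₁ Y + T.W₂ Y + T.W₃ Y + T.W₄ Y + T.W₅ Y‖
        ≤ ‖T.W₁ Y + T.W₂ Y + T.W₃ Y + T.W₄ Y‖ + ‖T.W₅ Y‖ := norm_add_le _ _
      _ ≤ ‖T.W₁ Y + T.W₂ Y + T.W₃ Y‖ + ‖T.W₄ Y‖ + ‖T.W₅ Y‖ := by gcongr; exact norm_add_le _ _
      _ ≤ ‖T.W₁ Y + T.W₂ Y‖ + ‖T.W₃ Y‖ + ‖T.W₄ Y‖ + ‖T.W₅ Y‖ := by gcongr; exact norm_add_le _ _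
      _ ≤ ‖T.W₁ Y‖ + ‖T.W₂ Y‖ + ‖T.W₃ Y‖ + ‖T.W₄ Y‖ + ‖T.W₅ Y‖ := by gcongr; exact norm_add_le _ _
  have hg := B11Smallness.prop4_gathering T.K₁ T.K₂ T.K₃ T.K₄ T.K₅ c ε₁ ε₃ T.K₁_nonneg T.K₃_nonneg T.K₄_nonneg
    hε₁c (hε₃a.trans T.a3_le_one)
  linarith

/-- **(97) as printed (strict)**: *"|((δ/δA′)V)(A′)| < C₄ε₃²(Lʲη)⁻³ on Ω_j"* for A′ with max{|A′|₍₋₁₎, |∇A′|₍₋₂₎} < ε₃, ε₃ ≦ a₃ (and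
the standing ε₁ ≦ c), with C₄ = `T.C4 c`. [cite: Balaban1985Variational, Prop. 4 (97) pp.292–293] -/
theorem ineq97 {c ε₃ : ℝ} (hε₁c : ε₁ ≤ c) (hε₃ : 0 < ε₃) (hε₃a : ε₃ ≤ T.a3) {Y : 𝒴} (hY : ‖Y‖ < ε₃) :
    ‖T.W Y‖ < T.C4 c * ε₃ ^ 2 := by
  have h := T.norm_W_le hε₁c hε₃ hε₃a hY
  have : (T.K₁ * c + T.K₂ + T.K₃ + T.K₄ * (c + 1) + T.K₅) * ε₃ ^ 2 < T.C4 c * ε₃ ^ 2 := by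
    unfold C4; nlinarith [pow_pos hε₃ 2]
  linarith

/-! ## §3 (98): «The above estimate can be formulated also in the following way» -/

/-- **(97) ⇒ (98)**: *"|((δ/δA′)V)(A′)|₍₋₃₎ ≦ C₄(max{|A′|₍₋₁₎, |∇A′|₍₋₂₎})², (98) and it is valid if max{…} ≦ a₃"* — here on the OPEN ball
‖A′‖ < a₃ (the termwise leaves are stated for ‖A′‖ < ε₃ ≦ a₃), by letting ε₃ ↓ ‖A′‖ in (97): if ‖W(A′)‖ ≦ Cε₃² for every ε₃ ∈ (‖A′‖, a₃],
then ‖W(A′)‖ ≦ C‖A′‖² (continuity of ε₃ ↦ Cε₃²). [cite: Balaban1985Variational, Prop. 4 (98) p.293] -/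
theorem ineq98_of_97 {C r : ℝ} {w y : ℝ} (hyr : y < r)
    (h97 : ∀ ε₃ : ℝ, y < ε₃ → ε₃ ≤ r → w ≤ C * ε₃ ^ 2) : w ≤ C * y ^ 2 := by
  -- ε₃ ↦ Cε₃² is continuous at y from the right; (y, r] is a neighbourhood within (y, ∞)
  have hcont : Tendsto (fun t : ℝ => C * t ^ 2) (𝓝[>] y) (𝓝 (C * y ^ 2)) :=
    ((continuous_const.mul (continuous_pow 2)).tendsto y).mono_left nhdsWithin_le_nhds
  have hmem : ∀ᶠ t in 𝓝[>] y, y < t ∧ t ≤ r := by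
    have h1 : ∀ᶠ t in 𝓝[>] y, y < t := eventually_nhdsWithin_of_forall fun t ht => ht
    have h2 : ∀ᶠ t in 𝓝[>] y, t ≤ r :=
      (eventually_le_nhds hyr).filter_mono nhdsWithin_le_nhds |>.mono fun t ht => ht
    exact h1.and h2
  have hle : ∀ᶠ t in 𝓝[>] y, w ≤ C * t ^ 2 := hmem.mono fun t ht => h97 t ht.1 ht.2
  exact ge_of_tendsto hcont hle

/-- **(98)** for the datum: ‖((δ/δA′)V)(A′)‖₍₋₃₎ ≦ C₄‖A′‖² for every A′ with ‖A′‖ < a₃ (ε₁ ≦ c standing).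
[cite: Balaban1985Variational, Prop. 4 (98) p.293] -/
theorem ineq98 {c : ℝ} (hε₁c : ε₁ ≤ c) {Y : 𝒴} (hY : ‖Y‖ < T.a3) : ‖T.W Y‖ ≤ T.C4 c * ‖Y‖ ^ 2 :=
  ineq98_of_97 hY fun _ h1 h2 => (T.ineq97 hε₁c (lt_of_le_of_lt (norm_nonneg Y) h1) h2 h1).le

/-! ## §4 Proposition 4 in the Fréchet form `B11Prop6Scheme.Prop4Hyp` and on the Prop-6 model family -/

/-- The sum (85) is analytic on {‖A′‖ < a₃} (each group is, by the leaves). [cite: Balaban1985Variational, Prop. 4 p.292] -/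
theorem differentiableOn_W : DifferentiableOn ℂ T.W {Y : 𝒴 | ‖Y‖ < T.a3} := by
  have hsub : {Y : 𝒴 | ‖Y‖ < T.a3} ⊆ {Y : 𝒴 | ‖Y‖ < T.a} := fun _ hY => lt_of_lt_of_le hY T.a3_le_a
  unfold W
  exact ((((T.an₁.mono hsub).add (T.an₂.mono hsub)).add (T.an₃.mono hsub)).add (T.an₄.mono hsub)).add (T.an₅.mono hsub)

/-- **Proposition 4 ⇐ the termwise leaves**, in the Fréchet form consumed by the Sect. E scheme (`B11Prop6Scheme.Prop4Hyp`, the INPUT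
field `prop4` of `B11Prop6Model.SchemeDatum`): the quadratic bound (98) with C₄ = `T.C4 c` and the analyticity on the ball ‖A′‖ < a₃ =
`T.a3`. [cite: Balaban1985Variational, Prop. 4 (97)–(98) pp.292–293] -/
theorem prop4Hyp {c : ℝ} (hε₁c : ε₁ ≤ c) : Prop4Hyp T.W (T.C4 c) T.a3 where
  quad _ hY := T.ineq98 hε₁c hY
  differentiableOn := T.differentiableOn_W

end TermwiseDatum

/-! ## §5 The Prop-6 scheme datum BUILT from the termwise leaves; Propositions 4 and 6 on that family -/

section Scheme

variable {𝒴 𝒵 Cfg Bdry : Type} [NormedAddCommGroup 𝒴] [NormedSpace ℂ 𝒴] [NormedAddCommGroup 𝒵] [NormedSpace ℂ 𝒵]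

/-- **The remaining data of the Sect. E scheme** once Proposition 4 is supplied by the termwise leaves: the scale data L, d with dL ≦ B₃,
𝔊 = G₁𝔓* with «By Theorem 3.13 of [5]» ‖𝔊f‖ ≦ B₀|f|₍₋₃₎ ((117), an INPUT), the current J(U₀) of (27) and H₁B(V, U₀) of (103) — i.e.
`B11Prop6Model.SchemeDatum` minus its `W`/`prop4` fields. [cite: Balaban1985Variational, (111), (115)–(117) pp.294–295] -/
structure SchemeRest (𝒴 𝒵 Cfg Bdry : Type) [NormedAddCommGroup 𝒴] [NormedSpace ℂ 𝒴] [NormedAddCommGroup 𝒵]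
    [NormedSpace ℂ 𝒵] (B₀ B₃ : ℝ) where
  L : ℝ
  dim : ℕ
  G : 𝒵 →L[ℂ] 𝒴
  J : Cfg → 𝒵
  H₁B : Bdry → Cfg → 𝒴
  norm_G : ∀ f, ‖G f‖ ≤ B₀ * ‖f‖
  L_nonneg : 0 ≤ L
  dL_le : (dim : ℝ) * L ≤ B₃

/-- **The scheme datum of `B11Prop6Model` with its Proposition-4 input DISCHARGED by the termwise leaves** (W := the sum (85),
`prop4 := T.prop4Hyp`, constants C₄ = `T.C4 c`, a₃ = `T.a3`). [cite: Balaban1985Variational, Prop. 4 pp.292–293 + Prop. 6 p.295] -/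
def schemeDatum {B₀ B₃ ε₁ c : ℝ} (T : TermwiseDatum 𝒴 𝒵 ε₁) (hε₁c : ε₁ ≤ c) (R : SchemeRest 𝒴 𝒵 Cfg Bdry B₀ B₃) :
    SchemeDatum 𝒴 𝒵 Cfg Bdry B₀ (T.C4 c) T.a3 B₃ where
  L := R.L
  dim := R.dim
  G := R.G
  W := T.W
  J := R.J
  H₁B := R.H₁B
  norm_G := R.norm_G
  prop4 := T.prop4Hyp hε₁c
  L_nonneg := R.L_nonneg
  dL_le := R.dL_le

/-- Unfolding: the scheme's W is the sum (85) of the datum. [cite: Balaban1985Variational, (85) p.291] -/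
theorem schemeDatum_W {B₀ B₃ ε₁ c : ℝ} (T : TermwiseDatum 𝒴 𝒵 ε₁) (hε₁c : ε₁ ≤ c) (R : SchemeRest 𝒴 𝒵 Cfg Bdry B₀ B₃) :
    (schemeDatum T hε₁c R).W = T.W := rfl

end Scheme

section Family

variable {I : Type} {𝒴 𝒵 : Type} [NormedAddCommGroup 𝒴] [NormedSpace ℂ 𝒴] [NormedAddCommGroup 𝒵] [NormedSpace ℂ 𝒵]
  (Cfgf Bdryf : I → Type)

/-- **Proposition 4, typed (`B11.Prop4Printed C₁ B₃ fam`), on the model family built from the termwise leaves** — by the gen-6 dictionary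
`B11Prop6Model.prop4Printed_model`, now fed by `prop4Hyp` instead of an assumed `Prop4Hyp`: for one termwise datum (printed constants K₁ … K₅,
a — «depend on d and L only» — and the standing ε₁ ≦ c) and a family of scheme rests (backgrounds, boundary data, 𝔊 per member), the typed
Proposition 4 holds with a₃ = ½min{a, 1}, C₄ = K₁c + K₂ + K₃ + K₄(c+1) + K₅ + 1. [cite: Balaban1985Variational, Prop. 4 (97)–(98) pp.292–293] -/
theorem prop4Printed_of_termwise {B₀ B₃ C₁ ε₁ c : ℝ} (T : TermwiseDatum 𝒴 𝒵 ε₁) (hε₁c : ε₁ ≤ c) (hC₄ : 0 < T.C4 c)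
    (R : ∀ i : I, SchemeRest 𝒴 𝒵 (Cfgf i) (Bdryf i) B₀ B₃) :
    B11.Prop4Printed C₁ B₃ (fun i => (schemeDatum T hε₁c (R i)).toLGData C₁) :=
  prop4Printed_model (fun _ => 𝒴) (fun _ => 𝒵) Cfgf Bdryf hC₄ T.a3_pos fun i => schemeDatum T hε₁c (R i)

/-- **Proposition 6 on the same family** (`B11Prop6Model.prop6Printed_model`): once Proposition 4 comes from the termwise leaves, the only
remaining analytic INPUT of the Sect. E scheme is «Theorem 3.13 of [5]» (‖𝔊f‖ ≦ B₀|f|₍₋₃₎). [cite: Balaban1985Variational, Prop. 6 pp.295–296] -/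
theorem prop6Printed_of_termwise [CompleteSpace 𝒴] {B₀ B₃ C₁ ε₁ c : ℝ} (T : TermwiseDatum 𝒴 𝒵 ε₁) (hε₁c : ε₁ ≤ c)
    (hB₀ : 0 < B₀) (hC₄ : 0 < T.C4 c) (hB₃ : 0 < B₃) (hC₁ : 0 < C₁)
    (R : ∀ i : I, SchemeRest 𝒴 𝒵 (Cfgf i) (Bdryf i) B₀ B₃) :
    B11.Prop6Printed B₀ B₃ C₁ (fun i => (schemeDatum T hε₁c (R i)).toLGData C₁) :=
  prop6Printed_model (fun _ => 𝒴) (fun _ => 𝒵) Cfgf Bdryf hB₀ hC₄ T.a3_pos hB₃ hC₁ fun i => schemeDatum T hε₁c (R i)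

end Family

end Literature.MathematicalPhysics.QuantumFieldTheory.Balaban1983to89.B11Prop4Assembly
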